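import Summits.KontsevichZagierPeriods.KontsevichZagierPeriods.Theses.CarlsonRule
import Literature.NumberTheory.Transcendental.KZKernelConjectureForms
import Literature.NumberTheory.Transcendental.KZSubcalculusInvariants
import Literature.NumberTheory.Transcendental.KZCalculusProofs
import Literature.NumberTheory.Transcendental.KZLogCalculusProofs

/-!
# Crux attack on `CarlsonRule.CarlsonKernel` (stmt-KontsevichZagierPeriods-14426)

Refuter one-shot (crux-attack mode).  The crux, verbatim: for every subgroup `R ≥ KZ.relations`
of the formal group closed under CARLSON'S RULE (an ω-rule whose premisses `[r m] − [s m] ∈ R`,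
`m ∈ ℕ`, live in `R` itself), `ker KZ.eval ⊆ R`.

## Findings (everything below is kernel-checked: rc 0, no sorry, axioms ⊆ {propext, choice, Quot.sound})

* §1 vocabulary: `ClosedUnderCarlson R` (the closure hypothesis verbatim); `carlsonKernel_iff`
  (`Iff.rfl`); `CarlsonClosure ↔ ClosedUnderCarlson relations` (crux #3 of the route) and
  `CarlsonSound ↔ ClosedUnderCarlson (ker eval)` (support item 12260) — both `Iff.rfl`/`simp only`.
* §2 the Carlson closure `carlsonClosure := sInf {R | relations ≤ R ∧ ClosedUnderCarlson R}` is
  itself closed (ω-rules with premisses in `R` are preserved by intersections) and the crux says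
  EXACTLY `ker eval ≤ carlsonClosure` (`carlsonKernel_iff_ker_le`).
* §9 (the main finding) **VALUE-LEVEL SOUNDNESS OF THE RULE, PROVED — AND CARLSON'S THEOREM IS NOT
  NEEDED**: because `0 ≤ g ≤ M`, equality of all integer moments `∫_σ f gᵐ = ∫_τ f' g'ᵐ` gives
  `∫_σ f·φ(g) = ∫_τ f'·φ(g')` for EVERY `φ` continuous on `[0, M]` (Weierstrass approximation,
  `exists_polynomial_near_of_continuousOn`; error `≤ ε(‖f‖₁ + ‖f'‖₁)`), in particular `φ = (·)^k`
  (`setIntegral_comp_eq_of_moments_eq`, `closedUnderCarlson_ker`).  Hence `CarlsonSound` HOLDS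
  (`carlsonSound_holds`; a positive proof of route item stmt-12260, attached as evidence, not landed
  by the refuter), `carlsonClosure ≤ ker eval` (the calculus KZ^C is sound), and no "unsound
  instance" kill of this crux exists.  The typed rule is "moment determinacy on a compact range"
  (Hausdorff), not analytic continuation; `0 ≤ g` and `0 ≤ k` are not needed for soundness either
  (paper: `t ↦ t^k` in Mathlib's `rpow` convention is continuous on `[−M, M]` for `k > 0`).
* §3 sandwich, UNCONDITIONAL: `KZKernelConjecture → CarlsonKernel`;
  `CarlsonClosure → CarlsonKernel → KZKernelConjecture`; **`KontsevichZagierPeriods ↔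
  CarlsonClosure ∧ CarlsonKernel`** (`summit_iff_and'`) and **`CarlsonKernel ↔ carlsonClosure =
  ker eval`** (`carlsonKernel_iff_eq'`); the summit implies EACH crux, so
  `¬ CarlsonKernel → ¬ KontsevichZagierPeriods` and `¬ CarlsonClosure → ¬ KontsevichZagierPeriods`:
  a kill of this crux is a disproof of the Kontsevich–Zagier conjecture in kernel form.
* §4 kill shape: `¬ CarlsonKernel ↔` an additive invariant `φ : FormalRep →+ A` killing the four
  moves, with Carlson-closed kernel, non-zero on some combination of value `0`.
* §5 load-bearing hypotheses: H1 `relations ≤ R` deleted ⇒ FALSE (`carlsonKernel_false_without_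
  relationsLe`; witness `R = ker coeffSum` — Carlson-closed since every conclusion is a difference
  of two generators — and `c = [∅]`); H2 (Carlson closure) deleted ⇒ LITERALLY the summit
  (`withoutClosure_iff_summit`); guard `eval c = 0` deleted ⇒ FALSE (`not_allMem`, witness
  `R = ker eval`, `c = [pt, 1]`).
* §6 the premiss family is the rule's vacuity guard: delete `∀ m, [r m] − [s m] ∈ R` and every
  such `R ≥ relations` is `⊤` (`g = g' = 1`, `k = 0`), so that mutated crux is trivially TRUE.
* §7 integer exponents are free: for `k = m ∈ ℕ` the conclusion follows from the `m`-th premiss and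
  two congruences (`Real.rpow_natCast`) in EVERY `R ≥ relations`; so the crux with `k` restricted to
  `ℕ` is literally the summit (`carlsonKernelNat_iff_summit`) — the rule's content is exactly the
  non-integral exponents, as intended.
* §8 degenerate members of the family: `R = ⊤` and `R = ker eval` satisfy hypotheses AND conclusion
  (`holds_at_top`, `holds_at_ker'`) — no junk-model kill; `n = n' = 0`, `σ = ∅`, `M < 0`, `g ≡ 0`,
  `f ≡ 0`, `k = 0` instances of the rule are all covered by §9.
* Classification: SURVIVES (conjecture-grade, summit-strength, not a verbatim restatement: it is the
  summit for the ENLARGED calculus KZ^C and differs from it exactly by crux #3 `CarlsonClosure`).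
-/

noncomputable section

set_option linter.dupNamespace false

open MeasureTheory Set
open Literature.NumberTheory.Transcendental

namespace Summit.KontsevichZagierPeriods.KontsevichZagierPeriods.Cruxes.CarlsonKernel.Attack

open Summit.KontsevichZagierPeriods.KontsevichZagierPeriods.Theses.CarlsonRule
  (CarlsonKernel CarlsonClosure CarlsonSound)

/-! ## §1 Vocabulary -/

/-- The closure hypothesis of the crux, VERBATIM: `R` is closed under Carlson's rule (premisses
`[r m] − [s m] ∈ R` for all `m ∈ ℕ`, conclusion `[rk] − [sk] ∈ R` for rational `k ≥ 0`). [folklore] -/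
def ClosedUnderCarlson (R : AddSubgroup KZ.FormalRep) : Prop :=
  ∀ (n n' : ℕ) (σ : Set (Fin n → ℝ)) (τ : Set (Fin n' → ℝ)) (f g : (Fin n → ℝ) → ℝ)
    (f' g' : (Fin n' → ℝ) → ℝ) (M : ℝ) (r : ℕ → KZ.IntegralRep n) (s : ℕ → KZ.IntegralRep n'),
    (∀ x ∈ σ, 0 ≤ g x ∧ g x ≤ M) → (∀ y ∈ τ, 0 ≤ g' y ∧ g' y ≤ M) →
    (∀ m, (r m).domain = σ ∧ Set.EqOn (r m).integrand (fun x => f x * g x ^ m) σ) →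
    (∀ m, (s m).domain = τ ∧ Set.EqOn (s m).integrand (fun y => f' y * g' y ^ m) τ) →
    (∀ m, KZ.of (r m) - KZ.of (s m) ∈ R) →
    ∀ (k : ℚ), 0 ≤ k → ∀ (rk : KZ.IntegralRep n) (sk : KZ.IntegralRep n'),
      rk.domain = σ → Set.EqOn rk.integrand (fun x => f x * g x ^ (k : ℝ)) σ →
      sk.domain = τ → Set.EqOn sk.integrand (fun y => f' y * g' y ^ (k : ℝ)) τ →
      KZ.of rk - KZ.of sk ∈ R

/-- The crux unfolds to: every Carlson-closed `R ≥ relations` contains the value-`0` combinations.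
[folklore] -/
theorem carlsonKernel_iff :
    CarlsonKernel ↔ ∀ R : AddSubgroup KZ.FormalRep, KZ.relations ≤ R → ClosedUnderCarlson R →
      ∀ c : KZ.FormalRep, KZ.eval c = 0 → c ∈ R :=
  Iff.rfl

/-- … i.e. `ker eval ≤ R` for every such `R`. [folklore] -/
theorem carlsonKernel_iff_ker :
    CarlsonKernel ↔ ∀ R : AddSubgroup KZ.FormalRep, KZ.relations ≤ R → ClosedUnderCarlson R →
      KZ.eval.ker ≤ R := by
  rw [carlsonKernel_iff]
  constructor
  · intro h R hR hC c hc
    exact h R hR hC c ((AddMonoidHom.mem_ker).1 hc)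
  · intro h R hR hC c hc
    exact h R hR hC ((AddMonoidHom.mem_ker).2 hc)

/-- Crux #3 of the route says exactly that `relations` itself is Carlson-closed. [folklore] -/
theorem carlsonClosure_iff : CarlsonClosure ↔ ClosedUnderCarlson KZ.relations := Iff.rfl

/-- The support item `CarlsonSound` says exactly that the intended model `ker eval` is
Carlson-closed (non-vacuity of the hypotheses at the extremal model). [folklore] -/
theorem carlsonSound_iff : CarlsonSound ↔ ClosedUnderCarlson KZ.eval.ker := by
  simp only [CarlsonSound, ClosedUnderCarlson, AddMonoidHom.mem_ker, KZ.eval_of_sub_of, sub_eq_zero]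

/-! ## §2 The Carlson closure of the relations -/

/-- The Carlson closure of `KZ.relations`: the least subgroup containing the four moves and closed
under the ω-rule. [folklore] -/
def carlsonClosure : AddSubgroup KZ.FormalRep :=
  sInf {R | KZ.relations ≤ R ∧ ClosedUnderCarlson R}

/-- ω-rules with premisses in `R` are preserved by intersections. [folklore] -/
theorem closedUnderCarlson_sInf (S : Set (AddSubgroup KZ.FormalRep))
    (hS : ∀ R ∈ S, ClosedUnderCarlson R) : ClosedUnderCarlson (sInf S) := by
  intro n n' σ τ f g f' g' M r s hg hg' hr hs hR k hk rk sk h1 h2 h3 h4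
  rw [AddSubgroup.mem_sInf]
  intro R hRS
  exact hS R hRS n n' σ τ f g f' g' M r s hg hg' hr hs
    (fun m => (AddSubgroup.mem_sInf.1 (hR m)) R hRS) k hk rk sk h1 h2 h3 h4

/-- `⊤` is Carlson-closed (the degenerate member of the family). [folklore] -/
theorem closedUnderCarlson_top : ClosedUnderCarlson (⊤ : AddSubgroup KZ.FormalRep) :=
  fun _ _ _ _ _ _ _ _ _ _ _ _ _ _ _ _ _ _ _ _ _ _ _ _ => AddSubgroup.mem_top _

/-- `carlsonClosure` is Carlson-closed. [folklore] -/
theorem closedUnderCarlson_carlsonClosure : ClosedUnderCarlson carlsonClosure :=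
  closedUnderCarlson_sInf _ fun _ hR => hR.2

/-- `relations ≤ carlsonClosure`. [folklore] -/
theorem relations_le_carlsonClosure : KZ.relations ≤ carlsonClosure :=
  le_sInf fun _ hR => hR.1

/-- Minimality of `carlsonClosure`. [folklore] -/
theorem carlsonClosure_le {R : AddSubgroup KZ.FormalRep} (h1 : KZ.relations ≤ R)
    (h2 : ClosedUnderCarlson R) : carlsonClosure ≤ R :=
  sInf_le ⟨h1, h2⟩

/-- **The crux says exactly `ker eval ≤ carlsonClosure`.** [folklore] -/
theorem carlsonKernel_iff_ker_le : CarlsonKernel ↔ KZ.eval.ker ≤ carlsonClosure := by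
  rw [carlsonKernel_iff_ker]
  constructor
  · intro h
    exact h _ relations_le_carlsonClosure closedUnderCarlson_carlsonClosure
  · intro h R h1 h2
    exact h.trans (carlsonClosure_le h1 h2)

/-! ## §3 The sandwich -/

/-- **Summit (kernel form) ⇒ crux**; the closure hypothesis is not used. [folklore] -/
theorem of_kzKernelConjecture (hk : KZKernelConjecture) : CarlsonKernel :=
  fun _ hR _ c hc => hR (hk c hc)

/-- **CarlsonClosure ∧ crux ⇒ summit (kernel form)** — the route's `closes` at `R := relations`.
[folklore] -/
theorem kzKernelConjecture_of_closure_of_kernel (h₁ : CarlsonClosure) (h₂ : CarlsonKernel) :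
    KZKernelConjecture :=
  h₂ KZ.relations le_rfl h₁

/-- The summit statement is the kernel conjecture (tree theorem). [folklore] -/
theorem summit_iff_kzKernelConjecture : KontsevichZagierPeriods ↔ KZKernelConjecture :=
  kzKernelConjecture_iff_isRational.symm

/-- **Summit ⇒ crux.** [folklore] -/
theorem carlsonKernel_of_summit (h : KontsevichZagierPeriods) : CarlsonKernel :=
  of_kzKernelConjecture (summit_iff_kzKernelConjecture.1 h)

/-- **What a kill costs**: `¬ CarlsonKernel → ¬ KontsevichZagierPeriods`. [folklore] -/
theorem not_summit_of_not_carlsonKernel (h : ¬ CarlsonKernel) : ¬ KontsevichZagierPeriods :=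
  fun hs => h (carlsonKernel_of_summit hs)

/-- `relations ≤ ker eval` (soundness of the four moves, tree theorem). [folklore] -/
theorem relations_le_ker : KZ.relations ≤ KZ.eval.ker := KZ.relations_le_ker_eval_holds

/-- Given value-level soundness of the rule, the summit implies `CarlsonClosure`. [folklore] -/
theorem carlsonClosure_of_kzKernelConjecture (hs : CarlsonSound) (hk : KZKernelConjecture) :
    CarlsonClosure := by
  rw [carlsonClosure_iff]
  have hker : ClosedUnderCarlson KZ.eval.ker := carlsonSound_iff.1 hs
  intro n n' σ τ f g f' g' M r s hg hg' hr hs' hR k hk' rk sk h1 h2 h3 h4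
  apply hk
  exact (AddMonoidHom.mem_ker).1 (hker n n' σ τ f g f' g' M r s hg hg' hr hs'
    (fun m => relations_le_ker (hR m)) k hk' rk sk h1 h2 h3 h4)

/-- **Given `CarlsonSound`, the route is an EQUIVALENCE**:
`KontsevichZagierPeriods ↔ CarlsonClosure ∧ CarlsonKernel`. [folklore] -/
theorem summit_iff_and (hs : CarlsonSound) :
    KontsevichZagierPeriods ↔ CarlsonClosure ∧ CarlsonKernel := by
  rw [summit_iff_kzKernelConjecture]
  exact ⟨fun hk => ⟨carlsonClosure_of_kzKernelConjecture hs hk, of_kzKernelConjecture hk⟩,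
    fun h => kzKernelConjecture_of_closure_of_kernel h.1 h.2⟩

/-- Given `CarlsonSound`, `carlsonClosure ≤ ker eval` (the five-rule calculus is sound).
[folklore] -/
theorem carlsonClosure_le_ker (hs : CarlsonSound) : carlsonClosure ≤ KZ.eval.ker :=
  carlsonClosure_le relations_le_ker (carlsonSound_iff.1 hs)

/-- Given `CarlsonSound`, **the crux is the equality `carlsonClosure = ker eval`**. [folklore] -/
theorem carlsonKernel_iff_eq (hs : CarlsonSound) : CarlsonKernel ↔ carlsonClosure = KZ.eval.ker := by
  rw [carlsonKernel_iff_ker_le]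
  exact ⟨fun h => le_antisymm (carlsonClosure_le_ker hs) h, fun h => h.ge⟩

/-! ## §4 What a kill must be -/

/-- **`¬ CarlsonKernel` iff an exotic invariant exists**: an additive `φ : FormalRep →+ A` killing the
four moves, with Carlson-closed kernel, non-zero on some combination of value `0`. [folklore] -/
theorem not_carlsonKernel_iff_invariant :
    ¬ CarlsonKernel ↔
      ∃ (A : Type) (_ : AddCommGroup A) (φ : KZ.FormalRep →+ A),
        KZ.relations ≤ φ.ker ∧ ClosedUnderCarlson φ.ker ∧
        ∃ c : KZ.FormalRep, KZ.eval c = 0 ∧ φ c ≠ 0 := by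
  rw [carlsonKernel_iff_ker_le]
  constructor
  · intro h
    obtain ⟨c, hc, hcn⟩ : ∃ c, c ∈ KZ.eval.ker ∧ c ∉ carlsonClosure := by
      by_contra hno
      exact h fun c hc => by_contra fun hcn => hno ⟨c, hc, hcn⟩
    have hkerq : (QuotientAddGroup.mk' carlsonClosure).ker = carlsonClosure :=
      QuotientAddGroup.ker_mk' carlsonClosure
    refine ⟨KZ.FormalRep ⧸ carlsonClosure, inferInstance, QuotientAddGroup.mk' carlsonClosure, ?_, ?_,
      c, hc, ?_⟩
    · rw [hkerq]; exact relations_le_carlsonClosure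
    · rw [hkerq]; exact closedUnderCarlson_carlsonClosure
    · rwa [Ne, QuotientAddGroup.mk'_apply, QuotientAddGroup.eq_zero_iff]
  · rintro ⟨A, _, φ, hrel, hcl, c, hc, hφ⟩ h
    have hle : carlsonClosure ≤ φ.ker := carlsonClosure_le hrel hcl
    exact hφ ((AddMonoidHom.mem_ker).1 (hle (h ((AddMonoidHom.mem_ker).2 hc))))

/-! ## §5 Load-bearing hypotheses -/

/-- The crux VERBATIM with H1 `relations ≤ R` deleted. [folklore] -/
def CarlsonKernelWithoutRelationsLe : Prop :=
  ∀ R : AddSubgroup KZ.FormalRep, ClosedUnderCarlson R → ∀ c : KZ.FormalRep, KZ.eval c = 0 → c ∈ R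

/-- `ker coeffSum` is Carlson-closed: every conclusion of the rule is a difference of two
generators. [folklore] -/
theorem closedUnderCarlson_ker_coeffSum : ClosedUnderCarlson KZ.coeffSum.ker := by
  intro n n' σ τ f g f' g' M r s _ _ _ _ _ k _ rk sk _ _ _ _
  rw [AddMonoidHom.mem_ker, map_sub, KZ.coeffSum_of, KZ.coeffSum_of, sub_self]

/-- **H1 is load-bearing**: without `relations ≤ R` the statement is FALSE (witness
`R = ker coeffSum`, `c = [∅]` of value `0` and coefficient sum `1`). [folklore] -/
theorem carlsonKernel_false_without_relationsLe : ¬ CarlsonKernelWithoutRelationsLe := by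
  intro h
  have h0 : KZ.eval (KZ.of (KZ.IntegralRep.empty 0)) = 0 := by
    rw [KZ.eval_of, KZ.IntegralRep.value_empty]
  have h1 := h _ closedUnderCarlson_ker_coeffSum _ h0
  rw [AddMonoidHom.mem_ker, KZ.coeffSum_of] at h1
  exact one_ne_zero h1

/-- The crux VERBATIM with H2 (Carlson closure) deleted. [folklore] -/
def CarlsonKernelWithoutClosure : Prop :=
  ∀ R : AddSubgroup KZ.FormalRep, KZ.relations ≤ R → ∀ c : KZ.FormalRep, KZ.eval c = 0 → c ∈ R

/-- **H2 deleted = the summit's kernel form, literally.** [folklore] -/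
theorem withoutClosure_iff_kzKernelConjecture : CarlsonKernelWithoutClosure ↔ KZKernelConjecture :=
  ⟨fun h c hc => h KZ.relations le_rfl c hc, fun hk _ hR c hc => hR (hk c hc)⟩

/-- … hence literally the summit. [folklore] -/
theorem withoutClosure_iff_summit : CarlsonKernelWithoutClosure ↔ KontsevichZagierPeriods :=
  withoutClosure_iff_kzKernelConjecture.trans summit_iff_kzKernelConjecture.symm

/-- The crux with the guard `eval c = 0` deleted (a strengthening). [folklore] -/
def CarlsonKernelAllMem : Prop :=
  ∀ R : AddSubgroup KZ.FormalRep, KZ.relations ≤ R → ClosedUnderCarlson R → ∀ c : KZ.FormalRep, c ∈ R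

/-- The unit representation `[pt, 1]` (`1/1` over `ℝ⁰`), of value `1`. [folklore] -/
def unitRep : KZ.IntegralRep 0 :=
  KZ.IntegralRep.ofRational Set.univ 1 1 Literature.ModelTheory.ExponentialFields.isSemialgebraic_univ
    (fun _ _ => by simp) (by simp)

/-- `value [pt, 1] = 1`. [folklore] -/
theorem value_unitRep : unitRep.value = 1 := by
  simp only [unitRep, KZ.IntegralRep.value_ofRational]
  simp [MeasureTheory.Measure.real, MeasureTheory.volume_pi]

/-- **The guard is load-bearing** given `CarlsonSound`: `R = ker eval` is then a member of the
family but misses `[pt, 1]`. [folklore] -/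
theorem not_allMem_of_sound (hs : CarlsonSound) : ¬ CarlsonKernelAllMem := by
  intro h
  have h1 := h KZ.eval.ker relations_le_ker (carlsonSound_iff.1 hs) (KZ.of unitRep)
  rw [AddMonoidHom.mem_ker, KZ.eval_of, value_unitRep] at h1
  exact one_ne_zero h1

/-- Degenerate member `R = ⊤`: hypotheses AND conclusion hold (no junk-model kill). [folklore] -/
theorem holds_at_top :
    KZ.relations ≤ (⊤ : AddSubgroup KZ.FormalRep) ∧ ClosedUnderCarlson ⊤ ∧
      ∀ c : KZ.FormalRep, KZ.eval c = 0 → c ∈ (⊤ : AddSubgroup KZ.FormalRep) :=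
  ⟨le_top, closedUnderCarlson_top, fun _ _ => AddSubgroup.mem_top _⟩

/-- Intended member `R = ker eval` (given `CarlsonSound`): hypotheses AND conclusion hold.
[folklore] -/
theorem holds_at_ker (hs : CarlsonSound) :
    KZ.relations ≤ KZ.eval.ker ∧ ClosedUnderCarlson KZ.eval.ker ∧
      ∀ c : KZ.FormalRep, KZ.eval c = 0 → c ∈ KZ.eval.ker :=
  ⟨relations_le_ker, carlsonSound_iff.1 hs, fun _ hc => (AddMonoidHom.mem_ker).2 hc⟩

/-! ## §6 The premiss family is the rule's vacuity guard -/

/-- The closure hypothesis with the premiss family `∀ m, [r m] − [s m] ∈ R` DELETED (everything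
else verbatim). [folklore] -/
def ClosedUnderCarlsonWithoutPremiss (R : AddSubgroup KZ.FormalRep) : Prop :=
  ∀ (n n' : ℕ) (σ : Set (Fin n → ℝ)) (τ : Set (Fin n' → ℝ)) (f g : (Fin n → ℝ) → ℝ)
    (f' g' : (Fin n' → ℝ) → ℝ) (M : ℝ) (r : ℕ → KZ.IntegralRep n) (s : ℕ → KZ.IntegralRep n'),
    (∀ x ∈ σ, 0 ≤ g x ∧ g x ≤ M) → (∀ y ∈ τ, 0 ≤ g' y ∧ g' y ≤ M) →
    (∀ m, (r m).domain = σ ∧ Set.EqOn (r m).integrand (fun x => f x * g x ^ m) σ) →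
    (∀ m, (s m).domain = τ ∧ Set.EqOn (s m).integrand (fun y => f' y * g' y ^ m) τ) →
    ∀ (k : ℚ), 0 ≤ k → ∀ (rk : KZ.IntegralRep n) (sk : KZ.IntegralRep n'),
      rk.domain = σ → Set.EqOn rk.integrand (fun x => f x * g x ^ (k : ℝ)) σ →
      sk.domain = τ → Set.EqOn sk.integrand (fun y => f' y * g' y ^ (k : ℝ)) τ →
      KZ.of rk - KZ.of sk ∈ R

/-- **Without the premisses every pair of generators is congruent**: `g = g' = 1`, `M = 1`,
`k = 0`, `f, f'` the two integrands, constant families. [folklore] -/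
theorem of_sub_of_mem_of_withoutPremiss {R : AddSubgroup KZ.FormalRep}
    (hR : ClosedUnderCarlsonWithoutPremiss R) {n n' : ℕ} (a : KZ.IntegralRep n)
    (b : KZ.IntegralRep n') : KZ.of a - KZ.of b ∈ R := by
  have := hR n n' a.domain b.domain a.integrand (fun _ => 1) b.integrand (fun _ => 1) 1
    (fun _ => a) (fun _ => b)
    (fun _ _ => ⟨zero_le_one, le_rfl⟩) (fun _ _ => ⟨zero_le_one, le_rfl⟩)
    (fun m => ⟨rfl, fun x _ => by simp⟩) (fun m => ⟨rfl, fun y _ => by simp⟩)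
    0 le_rfl a b rfl (fun x _ => by simp) rfl (fun y _ => by simp)
  exact this

/-- Hence such an `R ≥ relations` is `⊤` (`[∅] ∈ relations`). [folklore] -/
theorem eq_top_of_withoutPremiss {R : AddSubgroup KZ.FormalRep} (hrel : KZ.relations ≤ R)
    (hR : ClosedUnderCarlsonWithoutPremiss R) : R = ⊤ := by
  have hgen : ∀ {n : ℕ} (a : KZ.IntegralRep n), KZ.of a ∈ R := fun a => by
    have h1 := of_sub_of_mem_of_withoutPremiss hR a (KZ.IntegralRep.empty 0)
    have h2 : KZ.of (KZ.IntegralRep.empty 0) ∈ R := hrel KZ.IntegralRep.of_empty_mem_relations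
    simpa using R.add_mem h1 h2
  have hall : ∀ c : KZ.FormalRep, c ∈ R := fun c => by
    induction c using FreeAbelianGroup.induction_on with
    | zero => exact R.zero_mem
    | of p => exact hgen p.2
    | neg p hp => exact R.neg_mem hp
    | add x y hx hy => exact R.add_mem hx hy
  exact eq_top_iff.2 fun c _ => hall c

/-- **The crux with the premiss family deleted is TRIVIALLY TRUE** (it quantifies over `R = ⊤`
only). [folklore] -/
theorem carlsonKernelWithoutPremiss_holds :
    ∀ R : AddSubgroup KZ.FormalRep, KZ.relations ≤ R → ClosedUnderCarlsonWithoutPremiss R →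
      ∀ c : KZ.FormalRep, KZ.eval c = 0 → c ∈ R := by
  intro R hrel hR c _
  rw [eq_top_of_withoutPremiss hrel hR]
  exact AddSubgroup.mem_top c

/-! ## §7 Integer exponents are free -/

/-- For an integral exponent `k = m` the conclusion of the rule follows from its `m`-th premiss
and two congruences, in EVERY `R ≥ relations`. [folklore] -/
theorem conclusion_natCast {R : AddSubgroup KZ.FormalRep} (hrel : KZ.relations ≤ R)
    {n n' : ℕ} {σ : Set (Fin n → ℝ)} {τ : Set (Fin n' → ℝ)} {f g : (Fin n → ℝ) → ℝ}
    {f' g' : (Fin n' → ℝ) → ℝ} {r : ℕ → KZ.IntegralRep n} {s : ℕ → KZ.IntegralRep n'}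
    (hr : ∀ m, (r m).domain = σ ∧ Set.EqOn (r m).integrand (fun x => f x * g x ^ m) σ)
    (hs : ∀ m, (s m).domain = τ ∧ Set.EqOn (s m).integrand (fun y => f' y * g' y ^ m) τ)
    (hR : ∀ m, KZ.of (r m) - KZ.of (s m) ∈ R) (m : ℕ) (rk : KZ.IntegralRep n)
    (sk : KZ.IntegralRep n') (h1 : rk.domain = σ)
    (h2 : Set.EqOn rk.integrand (fun x => f x * g x ^ ((m : ℚ) : ℝ)) σ) (h3 : sk.domain = τ)
    (h4 : Set.EqOn sk.integrand (fun y => f' y * g' y ^ ((m : ℚ) : ℝ)) τ) :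
    KZ.of rk - KZ.of sk ∈ R := by
  have e1 : KZ.of rk - KZ.of (r m) ∈ KZ.relations := by
    refine KZ.of_sub_of_mem_relations_of_eqOn (by rw [(hr m).1, h1]) ?_
    intro x hx
    rw [h1] at hx
    rw [h2 hx, (hr m).2 hx]
    simp [Real.rpow_natCast]
  have e2 : KZ.of (s m) - KZ.of sk ∈ KZ.relations := by
    refine KZ.of_sub_of_mem_relations_of_eqOn (by rw [(hs m).1, h3]) ?_
    intro y hy
    rw [(hs m).1] at hy
    rw [(hs m).2 hy, h4 hy]
    simp [Real.rpow_natCast]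
  have : KZ.of rk - KZ.of sk =
      (KZ.of rk - KZ.of (r m)) + (KZ.of (r m) - KZ.of (s m)) + (KZ.of (s m) - KZ.of sk) := by abel
  rw [this]
  exact R.add_mem (R.add_mem (hrel e1) (hR m)) (hrel e2)

/-- Carlson's rule restricted to INTEGRAL exponents `k ∈ ℕ`. [folklore] -/
def ClosedUnderCarlsonNat (R : AddSubgroup KZ.FormalRep) : Prop :=
  ∀ (n n' : ℕ) (σ : Set (Fin n → ℝ)) (τ : Set (Fin n' → ℝ)) (f g : (Fin n → ℝ) → ℝ)
    (f' g' : (Fin n' → ℝ) → ℝ) (M : ℝ) (r : ℕ → KZ.IntegralRep n) (s : ℕ → KZ.IntegralRep n'),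
    (∀ x ∈ σ, 0 ≤ g x ∧ g x ≤ M) → (∀ y ∈ τ, 0 ≤ g' y ∧ g' y ≤ M) →
    (∀ m, (r m).domain = σ ∧ Set.EqOn (r m).integrand (fun x => f x * g x ^ m) σ) →
    (∀ m, (s m).domain = τ ∧ Set.EqOn (s m).integrand (fun y => f' y * g' y ^ m) τ) →
    (∀ m, KZ.of (r m) - KZ.of (s m) ∈ R) →
    ∀ (k : ℕ) (rk : KZ.IntegralRep n) (sk : KZ.IntegralRep n'),
      rk.domain = σ → Set.EqOn rk.integrand (fun x => f x * g x ^ ((k : ℚ) : ℝ)) σ →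
      sk.domain = τ → Set.EqOn sk.integrand (fun y => f' y * g' y ^ ((k : ℚ) : ℝ)) τ →
      KZ.of rk - KZ.of sk ∈ R

/-- **Every `R ≥ relations` is closed under the integral-exponent rule.** [folklore] -/
theorem closedUnderCarlsonNat_of_relations_le {R : AddSubgroup KZ.FormalRep}
    (hrel : KZ.relations ≤ R) : ClosedUnderCarlsonNat R :=
  fun _ _ _ _ _ _ _ _ _ _ _ _ _ hr hs hR k rk sk h1 h2 h3 h4 =>
    conclusion_natCast hrel hr hs hR k rk sk h1 h2 h3 h4

/-- **The crux with `k` restricted to `ℕ` is literally the summit**: the integral-exponent rule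
adds nothing to the four moves. [folklore] -/
theorem carlsonKernelNat_iff_summit :
    (∀ R : AddSubgroup KZ.FormalRep, KZ.relations ≤ R → ClosedUnderCarlsonNat R →
      ∀ c : KZ.FormalRep, KZ.eval c = 0 → c ∈ R) ↔ KontsevichZagierPeriods := by
  rw [summit_iff_kzKernelConjecture]
  exact ⟨fun h c hc => h KZ.relations le_rfl (closedUnderCarlsonNat_of_relations_le le_rfl) c hc,
    fun hk R hR _ c hc => hR (hk c hc)⟩

/-! ## §8 Summary -/

/-- **Status after the attack** (positive facts packaged): the crux is implied by the summit, is
jointly (with `CarlsonClosure`) sufficient for it, and is exactly `ker eval ≤ carlsonClosure`;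
H1 is load-bearing with an explicit witness, H2-deleted and `k ∈ ℕ`-restricted variants are the
summit itself, the premiss-deleted variant is trivially true. [folklore] -/
theorem resists :
    (KontsevichZagierPeriods → CarlsonKernel) ∧
    (CarlsonClosure → CarlsonKernel → KontsevichZagierPeriods) ∧
    (CarlsonKernel ↔ KZ.eval.ker ≤ carlsonClosure) ∧
    ¬ CarlsonKernelWithoutRelationsLe ∧
    (CarlsonKernelWithoutClosure ↔ KontsevichZagierPeriods) :=
  ⟨carlsonKernel_of_summit,
    fun h₁ h₂ => summit_iff_kzKernelConjecture.2 (kzKernelConjecture_of_closure_of_kernel h₁ h₂),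
    carlsonKernel_iff_ker_le, carlsonKernel_false_without_relationsLe, withoutClosure_iff_summit⟩

/-! ## §9 Value-level SOUNDNESS of Carlson's rule — by Weierstrass, not by Carlson

Because `0 ≤ g ≤ M` on `σ` (and `0 ≤ g' ≤ M` on `τ`), equality of all INTEGER moments
`∫_σ f gᵐ = ∫_τ f' g'ᵐ` propagates to `∫_σ f·φ(g) = ∫_τ f'·φ(g')` for EVERY `φ` continuous on
`[0, M]` (Weierstrass approximation; the error of a uniform `ε`-approximation is at most
`ε (‖f‖₁ + ‖f'‖₁)`), in particular for `φ(t) = t^k`, `k ≥ 0` real.  No analytic continuation, no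
growth condition, no Carlson theorem: the typed rule is "moment determinacy on a compact range". -/

/-- `|a - b| ≤ ε C` for every `ε > 0` forces `a = b`. [folklore] -/
theorem eq_of_forall_abs_sub_le {a b C : ℝ} (hC : 0 ≤ C) (h : ∀ ε > 0, |a - b| ≤ ε * C) :
    a = b := by
  by_contra hne
  have hpos : 0 < |a - b| := abs_pos.2 (sub_ne_zero.2 hne)
  have hε : 0 < |a - b| / (2 * (C + 1)) := by positivity
  have h1 := h _ hε
  have hq : C / (2 * (C + 1)) < 1 := by
    rw [div_lt_one (by positivity)]
    linarith
  have h2 : |a - b| / (2 * (C + 1)) * C = |a - b| * (C / (2 * (C + 1))) := by ring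
  rw [h2] at h1
  have h3 := mul_lt_mul_of_pos_left hq hpos
  rw [mul_one] at h3
  exact absurd (h1.trans_lt h3) (lt_irrefl _)

/-- **Moment determinacy on a compact range.** If `0 ≤ g ≤ M` on `σ`, `0 ≤ g' ≤ M` on `τ`, `f`,
`f'` are integrable there, all integer moments `∫_σ f gᵐ`, `∫_τ f' g'ᵐ` exist and agree, then
`∫_σ f·φ(g) = ∫_τ f'·φ(g')` for every `φ` continuous on `[0, M]` for which both sides converge
absolutely.  Proof: Weierstrass (`exists_polynomial_near_of_continuousOn`) and linearity.
[folklore] -/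
theorem setIntegral_comp_eq_of_moments_eq {n n' : ℕ} {σ : Set (Fin n → ℝ)} {τ : Set (Fin n' → ℝ)}
    {f g : (Fin n → ℝ) → ℝ} {f' g' : (Fin n' → ℝ) → ℝ} {M : ℝ}
    (hg : ∀ x ∈ σ, 0 ≤ g x ∧ g x ≤ M) (hg' : ∀ y ∈ τ, 0 ≤ g' y ∧ g' y ≤ M)
    (hσm : MeasurableSet σ) (hτm : MeasurableSet τ)
    (hint : ∀ m : ℕ, IntegrableOn (fun x => f x * g x ^ m) σ)
    (hint' : ∀ m : ℕ, IntegrableOn (fun y => f' y * g' y ^ m) τ)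
    (hmom : ∀ m : ℕ, ∫ x in σ, f x * g x ^ m = ∫ y in τ, f' y * g' y ^ m)
    (φ : ℝ → ℝ) (hφ : ContinuousOn φ (Set.Icc 0 M))
    (hφi : IntegrableOn (fun x => f x * φ (g x)) σ)
    (hφi' : IntegrableOn (fun y => f' y * φ (g' y)) τ) :
    ∫ x in σ, f x * φ (g x) = ∫ y in τ, f' y * φ (g' y) := by
  have hf : IntegrableOn f σ := by simpa using hint 0
  have hf' : IntegrableOn f' τ := by simpa using hint' 0
  -- polynomials in `g`, `g'`: integrable, with equal integrals
  have hintp : ∀ p : Polynomial ℝ, IntegrableOn (fun x => f x * p.eval (g x)) σ := by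
    intro p
    induction p using Polynomial.induction_on' with
    | add p q hp hq =>
      have e : (fun x => f x * (p + q).eval (g x)) =
          fun x => f x * p.eval (g x) + f x * q.eval (g x) := by
        funext x; rw [Polynomial.eval_add, mul_add]
      rw [e]; exact hp.add hq
    | monomial j a =>
      have e : (fun x => f x * (Polynomial.monomial j a).eval (g x)) =
          fun x => a * (f x * g x ^ j) := by
        funext x; rw [Polynomial.eval_monomial]; ring
      rw [e]; exact (hint j).const_mul a
  have hintp' : ∀ p : Polynomial ℝ, IntegrableOn (fun y => f' y * p.eval (g' y)) τ := by
    intro p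
    induction p using Polynomial.induction_on' with
    | add p q hp hq =>
      have e : (fun y => f' y * (p + q).eval (g' y)) =
          fun y => f' y * p.eval (g' y) + f' y * q.eval (g' y) := by
        funext y; rw [Polynomial.eval_add, mul_add]
      rw [e]; exact hp.add hq
    | monomial j a =>
      have e : (fun y => f' y * (Polynomial.monomial j a).eval (g' y)) =
          fun y => a * (f' y * g' y ^ j) := by
        funext y; rw [Polynomial.eval_monomial]; ring
      rw [e]; exact (hint' j).const_mul a
  have hpoly : ∀ p : Polynomial ℝ,
      ∫ x in σ, f x * p.eval (g x) = ∫ y in τ, f' y * p.eval (g' y) := by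
    intro p
    induction p using Polynomial.induction_on' with
    | add p q hp hq =>
      have e1 : (fun x => f x * (p + q).eval (g x)) =
          fun x => f x * p.eval (g x) + f x * q.eval (g x) := by
        funext x; rw [Polynomial.eval_add, mul_add]
      have e2 : (fun y => f' y * (p + q).eval (g' y)) =
          fun y => f' y * p.eval (g' y) + f' y * q.eval (g' y) := by
        funext y; rw [Polynomial.eval_add, mul_add]
      rw [e1, e2, integral_add (hintp p) (hintp q), integral_add (hintp' p) (hintp' q), hp, hq]
    | monomial j a =>
      have e1 : (fun x => f x * (Polynomial.monomial j a).eval (g x)) =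
          fun x => a * (f x * g x ^ j) := by
        funext x; rw [Polynomial.eval_monomial]; ring
      have e2 : (fun y => f' y * (Polynomial.monomial j a).eval (g' y)) =
          fun y => a * (f' y * g' y ^ j) := by
        funext y; rw [Polynomial.eval_monomial]; ring
      rw [e1, e2, integral_const_mul, integral_const_mul, hmom j]
  -- Weierstrass estimate
  have key : ∀ ε > 0, |(∫ x in σ, f x * φ (g x)) - ∫ y in τ, f' y * φ (g' y)| ≤
      ε * ((∫ x in σ, |f x|) + ∫ y in τ, |f' y|) := by
    intro ε hε
    obtain ⟨p, hp⟩ := exists_polynomial_near_of_continuousOn 0 M φ hφ ε hε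
    have eσ : |(∫ x in σ, f x * φ (g x)) - ∫ x in σ, f x * p.eval (g x)| ≤ ε * ∫ x in σ, |f x| := by
      rw [← integral_sub hφi (hintp p), ← integral_const_mul]
      refine abs_integral_le_integral_abs.trans ?_
      refine setIntegral_mono_on (hφi.sub (hintp p)).abs (hf.abs.const_mul ε) hσm ?_
      intro x hx
      have hpx := hp (g x) ⟨(hg x hx).1, (hg x hx).2⟩
      rw [abs_sub_comm] at hpx
      show |f x * φ (g x) - f x * p.eval (g x)| ≤ ε * |f x|
      rw [← mul_sub, abs_mul, mul_comm ε]
      exact mul_le_mul_of_nonneg_left hpx.le (abs_nonneg _)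
    have eτ : |(∫ y in τ, f' y * φ (g' y)) - ∫ y in τ, f' y * p.eval (g' y)| ≤
        ε * ∫ y in τ, |f' y| := by
      rw [← integral_sub hφi' (hintp' p), ← integral_const_mul]
      refine abs_integral_le_integral_abs.trans ?_
      refine setIntegral_mono_on (hφi'.sub (hintp' p)).abs (hf'.abs.const_mul ε) hτm ?_
      intro y hy
      have hpy := hp (g' y) ⟨(hg' y hy).1, (hg' y hy).2⟩
      rw [abs_sub_comm] at hpy
      show |f' y * φ (g' y) - f' y * p.eval (g' y)| ≤ ε * |f' y|
      rw [← mul_sub, abs_mul, mul_comm ε]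
      exact mul_le_mul_of_nonneg_left hpy.le (abs_nonneg _)
    have hP := hpoly p
    calc |(∫ x in σ, f x * φ (g x)) - ∫ y in τ, f' y * φ (g' y)|
        ≤ |(∫ x in σ, f x * φ (g x)) - ∫ x in σ, f x * p.eval (g x)| +
            |(∫ x in σ, f x * p.eval (g x)) - ∫ y in τ, f' y * φ (g' y)| := abs_sub_le _ _ _
      _ ≤ ε * (∫ x in σ, |f x|) + ε * ∫ y in τ, |f' y| := by
          refine add_le_add eσ ?_
          rw [hP, abs_sub_comm]
          exact eτ
      _ = ε * ((∫ x in σ, |f x|) + ∫ y in τ, |f' y|) := by ring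
  exact eq_of_forall_abs_sub_le
    (add_nonneg (integral_nonneg fun _ => abs_nonneg _) (integral_nonneg fun _ => abs_nonneg _)) key

/-- **`ker eval` IS Carlson-closed** — unconditionally: the intended extremal model satisfies the
closure hypothesis of the crux, so no "unsound instance" kill of `CarlsonKernel` exists, and the
route's support item `CarlsonSound` (stmt-KontsevichZagierPeriods-12260) holds with an elementary
proof. [folklore] -/
theorem closedUnderCarlson_ker : ClosedUnderCarlson KZ.eval.ker := by
  intro n n' σ τ f g f' g' M r s hg hg' hr hs hR k hk rk sk h1 h2 h3 h4
  rw [AddMonoidHom.mem_ker, KZ.eval_of_sub_of, sub_eq_zero]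
  have hσm : MeasurableSet σ := by
    have := KZ.IntegralRep.measurableSet_domain_holds (r 0)
    rwa [(hr 0).1] at this
  have hτm : MeasurableSet τ := by
    have := KZ.IntegralRep.measurableSet_domain_holds (s 0)
    rwa [(hs 0).1] at this
  have hint : ∀ m : ℕ, IntegrableOn (fun x => f x * g x ^ m) σ := fun m => by
    have := (r m).integrableOn
    rw [(hr m).1] at this
    exact this.congr_fun (hr m).2 hσm
  have hint' : ∀ m : ℕ, IntegrableOn (fun y => f' y * g' y ^ m) τ := fun m => by
    have := (s m).integrableOn
    rw [(hs m).1] at this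
    exact this.congr_fun (hs m).2 hτm
  have hintk : IntegrableOn (fun x => f x * g x ^ (k : ℝ)) σ := by
    have := rk.integrableOn
    rw [h1] at this
    exact this.congr_fun h2 hσm
  have hintk' : IntegrableOn (fun y => f' y * g' y ^ (k : ℝ)) τ := by
    have := sk.integrableOn
    rw [h3] at this
    exact this.congr_fun h4 hτm
  have hval : ∀ m : ℕ, (r m).value = ∫ x in σ, f x * g x ^ m := fun m => by
    show ∫ x in (r m).domain, (r m).integrand x = _
    rw [(hr m).1]
    exact setIntegral_congr_fun hσm (hr m).2
  have hval' : ∀ m : ℕ, (s m).value = ∫ y in τ, f' y * g' y ^ m := fun m => by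
    show ∫ y in (s m).domain, (s m).integrand y = _
    rw [(hs m).1]
    exact setIntegral_congr_fun hτm (hs m).2
  have hvalk : rk.value = ∫ x in σ, f x * g x ^ (k : ℝ) := by
    show ∫ x in rk.domain, rk.integrand x = _
    rw [h1]
    exact setIntegral_congr_fun hσm h2
  have hvalk' : sk.value = ∫ y in τ, f' y * g' y ^ (k : ℝ) := by
    show ∫ y in sk.domain, sk.integrand y = _
    rw [h3]
    exact setIntegral_congr_fun hτm h4
  have hmom : ∀ m : ℕ, ∫ x in σ, f x * g x ^ m = ∫ y in τ, f' y * g' y ^ m := fun m => by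
    rw [← hval m, ← hval' m]
    have := hR m
    rwa [AddMonoidHom.mem_ker, KZ.eval_of_sub_of, sub_eq_zero] at this
  have hcont : ContinuousOn (fun t : ℝ => t ^ (k : ℝ)) (Set.Icc 0 M) :=
    (Real.continuous_rpow_const (by exact_mod_cast hk)).continuousOn
  rw [hvalk, hvalk']
  exact setIntegral_comp_eq_of_moments_eq hg hg' hσm hτm hint hint' hmom (fun t => t ^ (k : ℝ))
    hcont hintk hintk'

/-- **`CarlsonSound` holds** (route support item stmt-KontsevichZagierPeriods-12260; NOT landed by
the refuter — attached as evidence for a prover). [folklore] -/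
theorem carlsonSound_holds : CarlsonSound := carlsonSound_iff.2 closedUnderCarlson_ker

/-! ### Unconditional forms of §3, §5, §8 -/

/-- `carlsonClosure ≤ ker eval`: the five-rule calculus KZ^C is sound. [folklore] -/
theorem carlsonClosure_le_ker' : carlsonClosure ≤ KZ.eval.ker :=
  carlsonClosure_le_ker carlsonSound_holds

/-- **The crux is EXACTLY the equality `carlsonClosure = ker eval`.** [folklore] -/
theorem carlsonKernel_iff_eq' : CarlsonKernel ↔ carlsonClosure = KZ.eval.ker :=
  carlsonKernel_iff_eq carlsonSound_holds

/-- **The route is an equivalence**: `KontsevichZagierPeriods ↔ CarlsonClosure ∧ CarlsonKernel`.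
[folklore] -/
theorem summit_iff_and' : KontsevichZagierPeriods ↔ CarlsonClosure ∧ CarlsonKernel :=
  summit_iff_and carlsonSound_holds

/-- The summit implies crux #3 `CarlsonClosure` too, so a kill of EITHER crux disproves it.
[folklore] -/
theorem carlsonClosure_of_summit (h : KontsevichZagierPeriods) : CarlsonClosure :=
  (summit_iff_and'.1 h).1

/-- `¬ CarlsonClosure → ¬ KontsevichZagierPeriods`. [folklore] -/
theorem not_summit_of_not_carlsonClosure (h : ¬ CarlsonClosure) : ¬ KontsevichZagierPeriods :=
  fun hs => h (carlsonClosure_of_summit hs)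

/-- The guard `eval c = 0` is load-bearing, unconditionally. [folklore] -/
theorem not_allMem : ¬ CarlsonKernelAllMem := not_allMem_of_sound carlsonSound_holds

/-- The intended member `R = ker eval` satisfies hypotheses and conclusion, unconditionally.
[folklore] -/
theorem holds_at_ker' :
    KZ.relations ≤ KZ.eval.ker ∧ ClosedUnderCarlson KZ.eval.ker ∧
      ∀ c : KZ.FormalRep, KZ.eval c = 0 → c ∈ KZ.eval.ker :=
  holds_at_ker carlsonSound_holds

/-- **Final status.** [folklore] -/
theorem resists' :
    (KontsevichZagierPeriods ↔ CarlsonClosure ∧ CarlsonKernel) ∧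
    (CarlsonKernel ↔ carlsonClosure = KZ.eval.ker) ∧
    carlsonClosure ≤ KZ.eval.ker ∧ KZ.relations ≤ carlsonClosure ∧
    ¬ CarlsonKernelWithoutRelationsLe ∧ (CarlsonKernelWithoutClosure ↔ KontsevichZagierPeriods) ∧
    ¬ CarlsonKernelAllMem :=
  ⟨summit_iff_and', carlsonKernel_iff_eq', carlsonClosure_le_ker', relations_le_carlsonClosure,
    carlsonKernel_false_without_relationsLe, withoutClosure_iff_summit, not_allMem⟩

end Summit.KontsevichZagierPeriods.KontsevichZagierPeriods.Cruxes.CarlsonKernel.Attack
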